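import Summits.ResolutionOfSingularities.ResolutionOfSingularities.Theorems.PurelyInseparableDim4ResConeDInfEntryFrame
import HarnessLib
import HarnessLib.Audit.Tags

/-!
# Purely inseparable four-folds — the ENTRY FRAME at a transversal state, EVERY PRIME `p` and every tame shade `d < p`
# (K2(p) lane, p-generic inventory toward K2(7); cell `res-dim4-pi`)

[OURS · counted 0 · cell `res-dim4-pi` · K2(p) lane holder res-dim4-p-12 g4's §18 «p-GENERIC INVENTORY toward K2(7)»; brick
«E_gen» of the E/K/L split of res-dim4-p-7 g5's «(p, p−1) D∞-type heavy line ⟸ W_{p−1}-pattern» (bus 2026-08-29 08:08:30Z (a));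
seat res-dim4-p-9 g5.]  Nothing here proves K2(p), K2(7), TAIL-D, the β_h line, or resolution of singularities in dimension ≥ 4 /
characteristic `p`.  AI kernel work, weaker than expert review.

The two ENTRY stubs of the `p = 5` programme — E `…ResConeBInfEntryFrame.stub_entryFrame` (p702794, `(p, d) = (5, 3)`) and E₄
`…ResConeDInfEntryFrame.stub_entryFrame₄` (p707534, `(5, 4)`) — use the prime only through the label lemma (`[CharP K 5]`,
`deg g < 5`) and the weights automata W₃/W₄ only through ONE fact: the blow-up direction at the state is TRANSVERSAL to the
boundary letter `W` (`w_W ≠ 0`).  This file states the entry frame with both inputs generic: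
* §1 **`label_of_dual_columns_char`** — the label lemma for any prime `p` and level `n`: `g ∈ 𝔪₀ⁿ` of total degree `< p` whose
  polar kernel contains the two `u`-columns of the dual basis lies in `(ℓ_{y₁}, ℓ_{y₂})ⁿ` (`label_of_dual_columns_pow` is the
  instance `p = 5`);
* §2 **`entryFrame_of_transversal`** (STATE level, no chain): an isolated state `F = x^r · G` with `ord₀ F = |r| + d`, `d < p`,
  `e_G = 2`, a boundary letter `W` with `p ≤ r_W + n`, `n ≤ d`, and a polar-kernel vector `w` with `w_W ≠ 0` admits a linear frame
  `L` with left inverse `M`, `L u₁ = e_W`, y-rows annihilating `resVertex`, and `μ = d` polygon of `(G)` with `pts ≠ ∅`,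
  `d! < δs`, `d·αs ≤ (n − 1)·d!`;
* §3 tail bookkeeping for ANY `(p, d)` — **`tail_ordZero_eq`**, **`tail_weights_laws`** (order, boundary law
  `r_{k+1} = (r_k|_{b_k=0}).update (j k) (|r_k| + d − p)`, band, isolation pair bound `≤ p − 2`), **`tail_factorisation`**,
  **`tail_step_factorisation`** (`three_/four_weights_laws`, `bInf_/dInf_factorisation` are the instances `(5,3)`/`(5,4)`);
* §4 **`heavy_entryFrame`** (CHAIN dress): along a witnessed isolated above-floor `Step0 p` chain with `x^{r₀} ∣ F₀`, constant
  shade `d < p` and `e_G = 2` from `k₀`, at any `k ≥ k₀` whose step direction is transversal to a letter `W` with `p ≤ r_k W + n`,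
  `n ≤ d`, the same frame exists — the transversality is a NAMED BINDER `hdirW` (discharged at `(5,3)`/`(5,4)` by
  `bInf_pattern`/`dInf_pattern`, at `(p, p−1)` by the W_{p−1}-pattern binder of the heavy-line file).
E and E₄ are the instances `(p, d, n) = (5, 3, 3)`, `(5, 4, 3)` with `r_W = 2`; they are NOT re-derived here.
CAVEAT OF RECORD (holder rulings 2026-08-29 08:19:54Z; idea-4 memo §5/§11.1): at `p ≥ 7` the heavy class of slice C`(p, p−1)`
is a zoo (`(2,2) · (3) · (3,2) · (4) · (1,3)` at `(7,6)`) — «light pair + D∞-type» exhausts slice C`(p, p−1)` ONLY at `p = 5`;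
the transversality binder `hdirW` here is exactly a D∞-SHAPE hypothesis on the step, supplied by whichever weights pattern
holds.  These are rung-1 generic bricks of a FUTURE K2(7) campaign — NOT K2(7), NOT a claim on slice B(7) or the `(7, d ≤ 5)` tails.
[cite: CossartJannsenSaito2020, Def. 8.2, Def. 8.4, Lemma 12.2 (2)] [cite: CossartPiltant2008, §4 p. 11] [cite: Hironaka1970AdditiveGroups, §1]
bears_on: LADDER-RESOLUTION:D157-DOOR2 (res-dim4-pi · K2(p) · p-generic entry frame E_gen).  Supports
stmt-ResolutionOfSingularities-16155 (helper).
-/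

set_option linter.dupNamespace false -- mandated namespace of this single-conjunct summit

noncomputable section

namespace Summit.ResolutionOfSingularities.ResolutionOfSingularities.Theorems.PIDim4

namespace ResCone

open MvPolynomial Finset IsLocalRing
open Literature.AlgebraicGeometry.Resolution
open Literature.AlgebraicGeometry.Resolution.CentreBlowup
open Literature.AlgebraicGeometry.Resolution.Hauser2010
open Literature.AlgebraicGeometry.Resolution.HauserPerlega2019
open Literature.AlgebraicGeometry.Resolution.WeightedOrder
open PointBlowup (additiveSubspace direction)

variable {K : Type} [Field K]

/-! ## 1. The label lemma, any prime `p` and any level `n` -/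

section Label

/-- **THE LABEL LEMMA, any prime `p`, any level `n`**: a polynomial `g ∈ 𝔪₀ⁿ` of total degree `< p = char K` whose polar kernel
contains the two `u`-columns of the dual basis lies in `(ℓ_{y₁}, ℓ_{y₂})ⁿ` (translation invariance of `g` along the additive
subspace, `PhiLine.aeval_add_sum_mul_eq_aeval`).  `label_of_dual_columns_pow` is the case `p = 5`. [OURS]
[cite: Hironaka1970AdditiveGroups, §1] [cite: CossartJannsenSaito2020, Def. 8.4] -/
theorem label_of_dual_columns_char (p n : ℕ) [CharP K p] {L : Fin (2 + 2) → Fin 4 → K} {M : Fin 4 → Fin (2 + 2) → K}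
    (hM : ∀ t u, ∑ i, M t i * L i u = if t = u then 1 else 0) {g : MvPolynomial (Fin 4) K}
    (hgn : g ∈ MvPolynomial.idealOfVars (Fin 4) K ^ n) (hdeg : g.totalDegree < p)
    (hu1 : (fun t => M t (u1 2)) ∈ additiveSubspace g) (hu2 : (fun t => M t (u2 2)) ∈ additiveSubspace g) :
    g ∈ Ideal.span (Set.range fun i : Fin 2 =>
      (∑ s, C (L (Fin.castAdd 2 i) s) * X s : MvPolynomial (Fin 4) K)) ^ n := by
  classical
  set ℓ : Fin (2 + 2) → MvPolynomial (Fin 4) K := fun i => ∑ s, C (L i s) * X s with hℓ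
  set I : Ideal (MvPolynomial (Fin 4) K) := Ideal.span (Set.range fun i : Fin 2 =>
    (∑ s, C (L (Fin.castAdd 2 i) s) * X s : MvPolynomial (Fin 4) K)) with hI
  set y : Fin 4 → MvPolynomial (Fin 4) K := fun t => C (M t 0) * ℓ 0 + C (M t 1) * ℓ 1 with hy
  -- the identity substitution, split into y-part and u-part
  have hsplit : (fun t => (X t : MvPolynomial (Fin 4) K)) =
      fun t => y t + ∑ i ∈ ({u1 2, u2 2} : Finset (Fin (2 + 2))),
        algebraMap K (MvPolynomial (Fin 4) K) ((fun i : Fin (2 + 2) => fun t : Fin 4 => M t i) i t) * ℓ i := by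
    funext t
    rw [X_eq_sum_C_mul_linearForm hM t, sum_frameIndex, Finset.sum_pair frameIndex_ne.2.2.2.2.2, hy]
    simp only [MvPolynomial.algebraMap_eq, hℓ]
    ring
  have hinv : aeval y g = g := by
    have h := PhiLine.aeval_add_sum_mul_eq_aeval p hdeg ({u1 2, u2 2} : Finset (Fin (2 + 2)))
      (t := fun i : Fin (2 + 2) => fun t : Fin 4 => M t i) (fun i hi => by
        rcases Finset.mem_insert.mp hi with h | h
        · rw [h]; exact hu1
        · rw [Finset.mem_singleton.mp h]; exact hu2) y ℓ
    rw [← hsplit, aeval_X_left_apply] at h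
    exact h.symm
  -- `aeval y` maps `𝔪₀` into `I`, hence `𝔪₀ⁿ` into `Iⁿ`
  have hmap : Ideal.map (aeval y).toRingHom (MvPolynomial.idealOfVars (Fin 4) K) ≤ I := by
    rw [MvPolynomial.idealOfVars, Ideal.map_span, Ideal.span_le]
    rintro _ ⟨_, ⟨t, rfl⟩, rfl⟩
    rw [AlgHom.toRingHom_eq_coe, RingHom.coe_coe, aeval_X, hy]
    refine I.add_mem (I.mul_mem_left _ (Ideal.subset_span ⟨0, rfl⟩)) (I.mul_mem_left _ (Ideal.subset_span ⟨1, rfl⟩))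
  rw [← hinv]
  have hmem : aeval y g ∈ Ideal.map (aeval y).toRingHom (MvPolynomial.idealOfVars (Fin 4) K ^ n) :=
    Ideal.mem_map_of_mem _ hgn
  rw [Ideal.map_pow] at hmem
  exact Ideal.pow_right_mono hmap n hmem

end Label

/-! ## 2. The entry frame at a transversal state (state level, any prime, any tame shade) -/

section Entry

variable {p : ℕ} [CharP K p]

/-- **THE ENTRY FRAME AT A TRANSVERSAL STATE, ANY PRIME `p`, ANY TAME SHADE `d < p`** (state level).  Let `s` be a presented
state with `x^{s.r} ∣ s.F`, `s.F` isolated (`IsIsolated p`), `ord₀ s.F = |r| + d` with `d < p`, `e_G = finrank (resVertex s) = 2`;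
let `W` be a boundary letter with `p ≤ r_W + n`, `n ≤ d` (supercritical exponent; heavy `r_W = 2`, `n = p − 2`), and let the
polar kernel `resVertex s` contain a vector `w` TRANSVERSAL to `W` (`w_W ≠ 0`).  Then there is a linear frame
`L : Fin (2+2) → Fin 4 → K` with left inverse `M` such that `L u₁ = e_W`, the two y-rows annihilate `resVertex s`, and the `μ = d`
polygon of `(G)`, `G = s.F / x^{s.r}`, in the regular system of parameters of `𝒪 = K[x]_{(x)}` attached to `L` has `pts ≠ ∅`,
`d! < δs` and `d·αs ≤ (n − 1)·d!`.  Frame and inverse: `exists_dualColumns` + `entryRows_mul`; `d·αs ≤ (n−1)·d!`: (K-Φ1)-n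
`PhiLine.mul_alphaS_le_of_isIsolated`; `d! < δs`: `label_of_dual_columns_char p d` on the degree-`d` residual cone (tame,
`d < p`) + `residual_mem_label_deg` + `PhiLine.factorial_lt_deltaS_span_singleton_iff`. [OURS]
[cite: CossartJannsenSaito2020, Def. 8.4, Lemma 12.2 (2)] [cite: CossartPiltant2008, §4 p. 11] -/
theorem entryFrame_of_transversal {d n : ℕ} (hdp : d < p) (hnd : n ≤ d) {s : State K} (hiso : IsIsolated p s.F)
    (hrs : ∀ e ∈ s.F.support, s.r ≤ e) (ho : ordZero s.F = ((s.r.degree + d : ℕ) : ℕ∞))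
    (he : Module.finrank K (resVertex s) = 2) {W : Fin 4} (hn : p ≤ s.r W + n)
    {w : Fin 4 → K} (hwV : w ∈ resVertex s) (hwW : w W ≠ 0) :
    ∃ (L : Fin (2 + 2) → Fin 4 → K) (M : Fin 4 → Fin (2 + 2) → K),
      (∀ t u, ∑ i, M t i * L i u = if t = u then 1 else 0) ∧ L (u1 2) = Pi.single W 1 ∧
      (∀ i, i ≠ u1 2 → i ≠ u2 2 → ∀ v ∈ resVertex s, ∑ t, L i t * v t = 0) ∧
      (pts (fun i => algebraMap (MvPolynomial (Fin 4) K) (OriginLocalization K 4) (∑ t, C (L i t) * X t))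
        (Ideal.span {algebraMap (MvPolynomial (Fin 4) K) (OriginLocalization K 4) (s.F.divMonomial s.r)}) d).Nonempty ∧
      Nat.factorial d < deltaS (fun i => algebraMap (MvPolynomial (Fin 4) K) (OriginLocalization K 4)
        (∑ t, C (L i t) * X t)) (Ideal.span {algebraMap (MvPolynomial (Fin 4) K) (OriginLocalization K 4)
          (s.F.divMonomial s.r)}) d ∧
      d * alphaS (fun i => algebraMap (MvPolynomial (Fin 4) K) (OriginLocalization K 4) (∑ t, C (L i t) * X t))
        (Ideal.span {algebraMap (MvPolynomial (Fin 4) K) (OriginLocalization K 4)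
          (s.F.divMonomial s.r)}) d ≤ (n - 1) * Nat.factorial d := by
  classical
  have hF : s.F = monomial s.r 1 * s.F.divMonomial s.r := eq_monomial_mul_divMonomial hrs
  -- dual columns and the two other letters
  obtain ⟨m, m₃, m₄, hmW, hm₃V, hm₄V, h₃W, h₃m, h₄W, h₄m⟩ := exists_dualColumns he hwV hwW
  obtain ⟨a, a', haW, ham, ha'W, ha'm, haa', hall⟩ := exists_two_other_letters (Ne.symm hmW)
  -- the frame and its inverse
  set rowA : Fin 4 → K := fun u =>
    (Pi.single a 1 : Fin 4 → K) u - m₃ a * (Pi.single W 1 : Fin 4 → K) u - m₄ a * (Pi.single m 1 : Fin 4 → K) u with hrowA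
  set rowA' : Fin 4 → K := fun u =>
    (Pi.single a' 1 : Fin 4 → K) u - m₃ a' * (Pi.single W 1 : Fin 4 → K) u - m₄ a' * (Pi.single m 1 : Fin 4 → K) u with hrowA'
  set L : Fin (2 + 2) → Fin 4 → K := fun i =>
    if i = u1 2 then Pi.single W 1 else if i = u2 2 then Pi.single m 1 else if i = 0 then rowA else rowA' with hL
  set M : Fin 4 → Fin (2 + 2) → K := fun t i =>
    if i = u1 2 then m₃ t else if i = u2 2 then m₄ t else if i = 0 then (Pi.single a 1 : Fin 4 → K) t
      else (Pi.single a' 1 : Fin 4 → K) t with hM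
  obtain ⟨h0u1, h0u2, h1u1, h1u2, h01, hu12⟩ := frameIndex_ne
  have hLu1 : L (u1 2) = Pi.single W 1 := by rw [hL]; exact if_pos rfl
  have hLu2 : L (u2 2) = Pi.single m 1 := by rw [hL]; simp only [if_neg (Ne.symm hu12), if_pos]
  have hL0 : L 0 = rowA := by rw [hL]; simp only [if_neg h0u1, if_neg h0u2, if_pos]
  have hL1 : L 1 = rowA' := by rw [hL]; simp only [if_neg h1u1, if_neg h1u2, if_neg (Ne.symm h01)]
  have hMu1 : ∀ t, M t (u1 2) = m₃ t := fun t => by rw [hM]; exact if_pos rfl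
  have hMu2 : ∀ t, M t (u2 2) = m₄ t := fun t => by rw [hM]; simp only [if_neg (Ne.symm hu12), if_pos]
  have hM0 : ∀ t, M t 0 = (Pi.single a 1 : Fin 4 → K) t := fun t => by rw [hM]; simp only [if_neg h0u1, if_neg h0u2, if_pos]
  have hM1 : ∀ t, M t 1 = (Pi.single a' 1 : Fin 4 → K) t := fun t => by
    rw [hM]; simp only [if_neg h1u1, if_neg h1u2, if_neg (Ne.symm h01)]
  have hinv : ∀ t u, ∑ i, M t i * L i u = if t = u then 1 else 0 := by
    intro t u
    rw [sum_frameIndex, hM0, hM1, hMu1, hMu2, hL0, hL1, hLu1, hLu2]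
    exact entryRows_mul haW ham ha'W ha'm haa' (Ne.symm hmW) hall h₃W h₃m h₄W h₄m t u
  -- the y-rows annihilate the polar kernel
  have hy : ∀ i, i ≠ u1 2 → i ≠ u2 2 → ∀ v ∈ resVertex s, ∑ t, L i t * v t = 0 := by
    intro i hi1 hi2 v hvV
    have hdec := apply_eq_of_mem_plane he hm₃V hm₄V h₃W h₃m h₄W h₄m hvV
    rcases frameIndex_cases i with hi | hi | hi | hi
    · rw [hi, hL0, hrowA, entryRow_dot, hdec a, hdec W, hdec m, h₃W, h₃m, h₄W, h₄m]; ring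
    · rw [hi, hL1, hrowA', entryRow_dot, hdec a', hdec W, hdec m, h₃W, h₃m, h₄W, h₄m]; ring
    · exact absurd hi hi1
    · exact absurd hi hi2
  -- polygon data in `𝒪`
  have hgen := PhiLine.span_range_linearFrame_eq_maximalIdeal L M hinv
  have hdim := PhiLine.ringKrullDim_originLocalization_two_add_two (K := K)
  have hu1' : (fun i => algebraMap (MvPolynomial (Fin 4) K) (OriginLocalization K 4) (∑ t, C (L i t) * X t)) (u1 2) =
      algebraMap (MvPolynomial (Fin 4) K) (OriginLocalization K 4) (X W) := by
    show algebraMap _ _ (∑ t, C (L (u1 2) t) * X t) = _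
    rw [hLu1, PhiLine.sum_C_single_mul_X]
  obtain ⟨hne, hα⟩ := PhiLine.mul_alphaS_le_of_isIsolated (d := d) (n := n) hF hiso (h := W) hn hnd _ hgen hu1'
  refine ⟨L, M, hinv, hLu1, hy, hne, ?_, hα⟩
  -- the label: `G ∈ (ℓ_y)^d ⊔ 𝔪₀^{d+1}`
  have hhom : (resForm s).IsHomogeneous d := by
    have h := resForm_isHomogeneous ho
    rwa [show s.r.degree + d - s.r.degree = d by omega] at h
  have hgd : resForm s ∈ MvPolynomial.idealOfVars (Fin 4) K ^ d := by
    rw [MvPolynomial.mem_pow_idealOfVars_iff']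
    intro x hx
    by_contra hne'
    have := hhom hne'
    rw [weight_one_eq_degree] at this
    omega
  have hcol1 : (fun t => M t (u1 2)) ∈ additiveSubspace (resForm s) := by
    rw [show (fun t => M t (u1 2)) = m₃ from funext hMu1]; exact hm₃V
  have hcol2 : (fun t => M t (u2 2)) ∈ additiveSubspace (resForm s) := by
    rw [show (fun t => M t (u2 2)) = m₄ from funext hMu2]; exact hm₄V
  have hlabel := residual_mem_label_deg d ho
    (label_of_dual_columns_char p d hinv hgd (lt_of_le_of_lt hhom.totalDegree_le hdp) hcol1 hcol2)
  exact (PhiLine.factorial_lt_deltaS_span_singleton_iff _ d hgen hdim hne).mpr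
    (PhiLine.algebraMap_mem_yIdeal_pow_sup L hlabel)

end Entry

/-! ## 3. Tail bookkeeping, any prime `p` and any shade `d`: order, boundary law, factorisation -/

section Tail

variable {p : ℕ} [Fact p.Prime] [DecidableEq K]

/-- **`ord₀ F_k = |r_k| + d` on a constant-shade tail, any prime `p`, any `d`.**  Along an isolated above-floor `Step0 p` chain
with `x^{r₀} ∣ F₀` and constant shade `d` from `k₀` (band `p < o_k < 2p`, `o_k − |r_k| = d`, and `|r_k| ≤ o_k` because
`x^{r_k} ∣ F_k`). `three_weights_laws`/`four_weights_laws` (1) are the instances `(p, d) = (5, 3), (5, 4)`. [OURS · bookkeeping]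
[cite: HauserPerlega2019PRIMS, §2 (transform D' of D)] -/
theorem tail_ordZero_eq {c : ℕ → State K} (hc : ∀ k, IsIsolated p (c k).F ∧ Step0 p (c k) (c (k + 1)))
    (hr0 : ∀ e ∈ (c 0).F.support, (c 0).r ≤ e) (hfloor : ∀ k, ordZero (c k).F ≠ p) {k₀ d : ℕ}
    (hshade : ∀ k, k₀ ≤ k → (c k).shade = ((d : ℕ) : ℕ∞)) {k : ℕ} (hk : k₀ ≤ k) :
    ordZero (c k).F = (((c k).r.degree + d : ℕ) : ℕ∞) ∧ p < (c k).r.degree + d ∧ (c k).r.degree + d < 2 * p := by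
  have hrk := IsolatedBand.isolated_chain_forall_le hc hr0 k
  obtain ⟨o, ho, hpo, ho2, hod⟩ := chain_shade_nat p hc hfloor hshade hk
  have hro : (c k).r.degree ≤ o := by
    obtain ⟨⟨e₀, he₀, he₀deg⟩, -⟩ := (ordZero_eq_nat_iff _ _).mp ho
    have h := PointBlowup.degree_le_degree_of_le (hrk e₀ (MvPolynomial.mem_support_iff.mpr he₀))
    omega
  have hode : o = (c k).r.degree + d := by omega
  exact ⟨by rw [ho, hode], by omega, by omega⟩

/-- **THE TAIL WEIGHTS LAWS, any prime `p`, any shade `d`** (the chain-to-automaton interface `three_weights_laws` /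
`four_weights_laws` with `(5, 3)`/`(5, 4)` replaced by `(p, d)`).  Along a witnessed isolated above-floor `Step0 p` chain with
`x^{r₀} ∣ F₀` and constant shade `d` from `k₀`: (1) `ord₀ F_k = |r_k| + d`; (2) the boundary law
`r_{k+1} = (r_k|_{b_k = 0}).update (j k) (|r_k| + d − p)` (a translated letter is lost, the newborn weighs `o_k − p`);
(3) `b k (j k) = 0`; (4) the band `p < |r_k| + d < 2p`; (5) the isolation pair bound `r_k i + r_k i′ ≤ p − 2`.
[OURS · bookkeeping] [cite: HauserPerlega2019PRIMS, §2 (transform D' of D)] -/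
theorem tail_weights_laws {c : ℕ → State K} {j : ℕ → Fin 4} {b : ℕ → Fin 4 → K}
    (hc : ∀ k, IsIsolated p (c k).F ∧ Step0 p (c k) (c (k + 1))) (hw : FreeTail.IsWitnessedChain p c j b)
    (hr0 : ∀ e ∈ (c 0).F.support, (c 0).r ≤ e) (hfloor : ∀ k, ordZero (c k).F ≠ p) {k₀ d : ℕ}
    (hshade : ∀ k, k₀ ≤ k → (c k).shade = ((d : ℕ) : ℕ∞)) :
    (∀ k, k₀ ≤ k → ordZero (c k).F = (((c k).r.degree + d : ℕ) : ℕ∞)) ∧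
    (∀ k, k₀ ≤ k →
      (c (k + 1)).r = ((c k).r.filter (fun i => b k i = 0)).update (j k) ((c k).r.degree + d - p)) ∧
    (∀ k, b k (j k) = 0) ∧ (∀ k, k₀ ≤ k → p < (c k).r.degree + d ∧ (c k).r.degree + d < 2 * p) ∧
    (∀ k, ∀ i i', i ≠ i' → (c k).r i + (c k).r i' ≤ p - 2) := by
  refine ⟨fun k hk => (tail_ordZero_eq hc hr0 hfloor hshade hk).1, fun k hk => ?_, fun k => (hw k).2.1,
    fun k hk => (tail_ordZero_eq hc hr0 hfloor hshade hk).2, fun k i i' hii' => ?_⟩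
  · rw [(hw k).2.2.2.2, step_r_univ' p (j k) (b k) (c k) (tail_ordZero_eq hc hr0 hfloor hshade hk).1]
  · exact IsolatedBand.apply_add_apply_le_of_isIsolated (Fact.out : p.Prime).two_le (hc k).1
      (IsolatedBand.isolated_chain_forall_le hc hr0 k) hii'

/-- **THE RESIDUAL FACTORISATION ON A CONSTANT-SHADE TAIL, any prime `p`, any shade `d`** (`bInf_factorisation` /
`dInf_factorisation` with `(5, 3)`/`(5, 4) ↦ (p, d)`): for `k ≥ k₀`, `(c k).F = x^{r_k} · G_k` with
`G_k = (c k).F.divMonomial (c k).r`, `ord₀ G_k = d`, the band `p < |r_k| + d < 2p`, and `x^{r_k} ∣ F_k` monomialwise — the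
`hF/hd/hpo/ho2/hdiv` binders of the Φ-line step laws and of `heavy_lose_step`. [OURS · bookkeeping]
[cite: Hauser2010, §F (setting f = x^p + y^r g)] -/
theorem tail_factorisation {c : ℕ → State K} (hc : ∀ k, IsIsolated p (c k).F ∧ Step0 p (c k) (c (k + 1)))
    (hr0 : ∀ e ∈ (c 0).F.support, (c 0).r ≤ e) (hfloor : ∀ k, ordZero (c k).F ≠ p) {k₀ d : ℕ}
    (hshade : ∀ k, k₀ ≤ k → (c k).shade = ((d : ℕ) : ℕ∞)) {k : ℕ} (hk : k₀ ≤ k) :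
    (c k).F = monomial (c k).r 1 * (c k).F.divMonomial (c k).r ∧
      ordZero ((c k).F.divMonomial (c k).r) = (d : ℕ) ∧ p < (c k).r.degree + d ∧ (c k).r.degree + d < 2 * p ∧
      (∀ e ∈ (c k).F.support, (c k).r ≤ e) := by
  have hrk := IsolatedBand.isolated_chain_forall_le hc hr0 k
  obtain ⟨ho, hpo, ho2⟩ := tail_ordZero_eq hc hr0 hfloor hshade hk
  have hF : (c k).F = monomial (c k).r 1 * (c k).F.divMonomial (c k).r := eq_monomial_mul_divMonomial hrk
  refine ⟨hF, ?_, hpo, ho2, hrk⟩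
  rw [hF, PhiLine.ordZero_monomial_one_mul, Nat.cast_add] at ho
  exact (add_right_inj_of_ne_top (ENat.coe_ne_top _)).mp ho

/-- **THE STEP FACTORISATION ON A CONSTANT-SHADE TAIL, any prime `p`, any shade `d`** (`bInf_step_factorisation` /
`dInf_step_factorisation` with `(5, 3)`/`(5, 4) ↦ (p, d)`): for `k ≥ k₀`,
`(step p univ (j k) (b k) (c k)).F = x^{(r_k|_{b_k = 0}).update (j k) (|r_k| + d − p)} · G_{k+1}` with
`G_{k+1} = (c (k+1)).F.divMonomial (c (k+1)).r` and `d ≤ ord₀ G_{k+1}` — the `hF′/hd′` binders of the Φ-line step laws.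
[OURS · bookkeeping] [cite: Hauser2010, §F (setting f = x^p + y^r g)] -/
theorem tail_step_factorisation {c : ℕ → State K} {j : ℕ → Fin 4} {b : ℕ → Fin 4 → K}
    (hc : ∀ k, IsIsolated p (c k).F ∧ Step0 p (c k) (c (k + 1))) (hw : FreeTail.IsWitnessedChain p c j b)
    (hr0 : ∀ e ∈ (c 0).F.support, (c 0).r ≤ e) (hfloor : ∀ k, ordZero (c k).F ≠ p) {k₀ d : ℕ}
    (hshade : ∀ k, k₀ ≤ k → (c k).shade = ((d : ℕ) : ℕ∞)) {k : ℕ} (hk : k₀ ≤ k) :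
    (CentreBlowup.step p Finset.univ (j k) (b k) (c k)).F =
        monomial ((((c k).r.filter fun i => b k i = 0)).update (j k) ((c k).r.degree + d - p)) 1 *
          (c (k + 1)).F.divMonomial (c (k + 1)).r ∧
      ((d : ℕ) : ℕ∞) ≤ ordZero ((c (k + 1)).F.divMonomial (c (k + 1)).r) := by
  obtain ⟨-, hlaw, -, -, -⟩ := tail_weights_laws hc hw hr0 hfloor hshade
  obtain ⟨hF₁, hd₁, -, -, -⟩ := tail_factorisation hc hr0 hfloor hshade (k := k + 1) (by omega)
  have hstep : c (k + 1) = CentreBlowup.step p Finset.univ (j k) (b k) (c k) := (hw k).2.2.2.2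
  refine ⟨?_, hd₁.symm.le⟩
  rw [← hstep, ← hlaw k hk]
  exact hF₁

end Tail

/-! ## 4. The chain dress: constant-shade `e_G = 2` tails of isolated above-floor `Step0 p` chains -/

section Chain

variable {p : ℕ} [Fact p.Prime] [CharP K p] [DecidableEq K]

/-- **THE HEAVY ENTRY FRAME, ANY PRIME `p` (chain dress of `entryFrame_of_transversal`).**  Along a witnessed isolated
above-floor `Step0 p` chain with `x^{r₀} ∣ F₀`, constant shade `d < p` and `e_G = 2` from `k₀`, at any `k ≥ k₀` and boundary
letter `W` with `p ≤ r_k W + n`, `n ≤ d`, such that the step direction is TRANSVERSAL to `W` (`(direction (j k) (b k)) W ≠ 0` —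
the named binder `hdirW`; at `(5,3)`/`(5,4)` it is W₃ `bInf_pattern` / W₄ `dInf_pattern` «the step hits the heavy letter», at
`(p, p−1)` the W_{p−1}-pattern binder), there is a linear frame `L` with left inverse `M`, `L u₁ = e_W`, y-rows annihilating
`resVertex (c k)`, and `μ = d` polygon of `(G_k)` with `pts ≠ ∅`, `d! < δs`, `d·αs ≤ (n − 1)·d!`.  E (p702794) and E₄ (p707534)
are the instances `(p, d, n, r_W) = (5, 3, 3, 2)`, `(5, 4, 3, 2)`. [OURS]
[cite: CossartJannsenSaito2020, Def. 8.4, Lemma 12.2 (2)] [cite: CossartPiltant2008, §4 p. 11] -/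
theorem heavy_entryFrame {d n : ℕ} (hdp : d < p) (hnd : n ≤ d) {c : ℕ → State K} {j : ℕ → Fin 4} {b : ℕ → Fin 4 → K}
    (hc : ∀ k, IsIsolated p (c k).F ∧ Step0 p (c k) (c (k + 1))) (hw : FreeTail.IsWitnessedChain p c j b)
    (hr0 : ∀ e ∈ (c 0).F.support, (c 0).r ≤ e) (hfloor : ∀ k, ordZero (c k).F ≠ p) {k₀ : ℕ}
    (hshade : ∀ k, k₀ ≤ k → (c k).shade = ((d : ℕ) : ℕ∞))
    (he : ∀ k, k₀ ≤ k → Module.finrank K (resVertex (c k)) = 2)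
    {k : ℕ} (hk : k₀ ≤ k) {W : Fin 4} (hn : p ≤ (c k).r W + n) (hdirW : direction (j k) (b k) W ≠ 0) :
    ∃ (L : Fin (2 + 2) → Fin 4 → K) (M : Fin 4 → Fin (2 + 2) → K),
      (∀ t u, ∑ i, M t i * L i u = if t = u then 1 else 0) ∧ L (u1 2) = Pi.single W 1 ∧
      (∀ i, i ≠ u1 2 → i ≠ u2 2 → ∀ v ∈ resVertex (c k), ∑ t, L i t * v t = 0) ∧
      (pts (fun i => algebraMap (MvPolynomial (Fin 4) K) (OriginLocalization K 4) (∑ t, C (L i t) * X t))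
        (Ideal.span {algebraMap (MvPolynomial (Fin 4) K) (OriginLocalization K 4)
          ((c k).F.divMonomial (c k).r)}) d).Nonempty ∧
      Nat.factorial d < deltaS (fun i => algebraMap (MvPolynomial (Fin 4) K) (OriginLocalization K 4)
        (∑ t, C (L i t) * X t)) (Ideal.span {algebraMap (MvPolynomial (Fin 4) K) (OriginLocalization K 4)
          ((c k).F.divMonomial (c k).r)}) d ∧
      d * alphaS (fun i => algebraMap (MvPolynomial (Fin 4) K) (OriginLocalization K 4) (∑ t, C (L i t) * X t))
        (Ideal.span {algebraMap (MvPolynomial (Fin 4) K) (OriginLocalization K 4)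
          ((c k).F.divMonomial (c k).r)}) d ≤ (n - 1) * Nat.factorial d :=
  entryFrame_of_transversal hdp hnd (hc k).1 (IsolatedBand.isolated_chain_forall_le hc hr0 k)
    (tail_ordZero_eq hc hr0 hfloor hshade hk).1 (he k hk) hn
    (chain_direction_mem_resVertex p hc hw hr0 hfloor hshade hk) hdirW

end Chain

end ResCone

end Summit.ResolutionOfSingularities.ResolutionOfSingularities.Theorems.PIDim4

end
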